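import Summits.CriticalPhenomena.CardyFormulaZ2.Theorems.CardyIKTransportIKLinearTransportSDECore7

/-!
# Stub `stub_StripDiagramExchange` — core part 8: lower slots and the exit bound

Continues `…SDECore7`. The LOWER SLOTS (rows `y_j, y_j - 1`, `y_j = -(n + 2 + 2j)`) and `SDE.P_noBlockD`; a
monochromatic strip path cannot cross two monochromatic rows of opposite colours (intermediate rows), so upward /
downward exits are blocked by blocking slots; THE EXIT BOUND `P(G_m) ≤ 2 |P| (1 - q^6)^k` (`SDE.P_Gex_le`).
-/

set_option autoImplicit false

noncomputable section

namespace Summit.CriticalPhenomena.CardyFormulaZ2.Theorems.IKLinearTransport.PinnedDiagramExchange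

open scoped Classical MeasureTheory ENNReal ProbabilityTheory BigOperators
open MeasureTheory Literature.Probability.Percolation Literature.Probability.LatticeModels

namespace SDE

/-! ## §19 Blocking pairs of rows below the starts -/

/-- Rows of the `j`-th lower slot: `y_j, y_j - 1` with `y_j = -(n + 2 + 2j)`. [folklore] -/
def yD (n j : ℕ) : ℤ := -((n : ℤ) + 2 + 2 * j)

/-- BLOCKING EVENT of the lower slot `j`: rows `y_j` and `y_j - 1` are monochromatic of opposite colours. [folklore] -/
def AD (τ κ₀ κ₂ : Bool) (n j : ℕ) : Set K :=
  {b | ∃ β : Bool, (∀ c : Fin 3, col τ κ₀ κ₂ b c (yD n j) = β) ∧ ∀ c : Fin 3, col τ κ₀ κ₂ b c (yD n j - 1) = !β}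

/-- Past bits of the lower slot `j`. [folklore] -/
def SD (n j : ℕ) : Finset Idx :=
  {((4 : Fin 5), (1 : ℤ))} ∪ ((({1, 3} : Finset (Fin 5)) ×ˢ Finset.Ico (yD n j + 1) 0) ∪
    (({0} : Finset (Fin 5)) ×ˢ Finset.Icc (yD n j + 1) 0))

/-- Fresh bits of the lower slot `j`. [folklore] -/
def ΦD (n j : ℕ) : Finset Idx :=
  {((1 : Fin 5), yD n j), ((3 : Fin 5), yD n j), ((1 : Fin 5), yD n j - 1), ((3 : Fin 5), yD n j - 1),
    ((0 : Fin 5), yD n j), ((0 : Fin 5), yD n j - 1)}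

/-- The fresh box of the lower slot `j`. [folklore] -/
def βD (n j : ℕ) (t₁ t₂ : Bool) (idx : Idx) : Bool :=
  if idx = ((1 : Fin 5), yD n j) then t₁ else if idx = ((3 : Fin 5), yD n j) then t₂
  else if idx = ((0 : Fin 5), yD n j - 1) then true else false

/-- Past statistics of the lower slot `j`. [folklore] -/
def TD (τ κ₀ κ₂ : Bool) (k : Fin 5) (n j : ℕ) (b : K) : Bool :=
  bp (fun s => b (k, s)) 0 (yD n j + 1) ^^ b (4, 1) ^^ κk τ κ₀ κ₂ k

/-- Membership in the past of a lower slot. [folklore] -/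
theorem mem_SD (n j : ℕ) (k : Fin 5) (y : ℤ) : (k, y) ∈ SD n j ↔
    (k = 4 ∧ y = 1) ∨ ((k = 1 ∨ k = 3) ∧ yD n j + 1 ≤ y ∧ y < 0) ∨ (k = 0 ∧ yD n j + 1 ≤ y ∧ y ≤ 0) := by
  simp only [SD, Finset.mem_union, Finset.mem_singleton, Prod.mk.injEq, Finset.mem_product, Finset.mem_insert,
    Finset.mem_Ico, Finset.mem_Icc]

/-- Membership in the fresh bits of a lower slot. [folklore] -/
theorem mem_ΦD (n j : ℕ) (k : Fin 5) (y : ℤ) : (k, y) ∈ ΦD n j ↔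
    ((k = 1 ∨ k = 3) ∧ (y = yD n j ∨ y = yD n j - 1)) ∨ (k = 0 ∧ (y = yD n j ∨ y = yD n j - 1)) := by
  simp only [ΦD, Finset.mem_insert, Finset.mem_singleton, Prod.mk.injEq]
  constructor
  · rintro (⟨rfl, rfl⟩ | ⟨rfl, rfl⟩ | ⟨rfl, rfl⟩ | ⟨rfl, rfl⟩ | ⟨rfl, rfl⟩ | ⟨rfl, rfl⟩) <;> simp
  · rintro (⟨rfl | rfl, rfl | rfl⟩ | ⟨rfl, rfl | rfl⟩) <;> simp

/-- The hypotheses of the abstract bound for the lower slots. [folklore] -/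
theorem slotsD_ok (τ κ₀ κ₂ : Bool) (n : ℕ) :
    (∀ j, SD n j ⊆ SD n (j + 1)) ∧ (∀ j, Disjoint (SD n j) (ΦD n j)) ∧
    (∀ j, AD τ κ₀ κ₂ n j ∈ DetSets (SD n (j + 1))) ∧
    (∀ j t, {b | TD τ κ₀ κ₂ 1 n j b = t} ∈ DetSets (SD n j) ∧ {b | TD τ κ₀ κ₂ 3 n j b = t} ∈ DetSets (SD n j)) ∧
    (∀ j t₁ t₂, Set.pi ↑(ΦD n j) (fun idx => {βD n j t₁ t₂ idx}) ∈ DetSets (ΦD n j)) ∧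
    (∀ j t₁ t₂, (qI : ℝ) ^ 6 ≤ P.real (Set.pi ↑(ΦD n j) (fun idx => {βD n j t₁ t₂ idx}))) ∧
    (∀ j t₁ t₂, Set.pi ↑(ΦD n j) (fun idx => {βD n j t₁ t₂ idx}) ∩ {b | TD τ κ₀ κ₂ 1 n j b = t₁} ∩
      {b | TD τ κ₀ κ₂ 3 n j b = t₂} ⊆ AD τ κ₀ κ₂ n j) := by
  have hy : ∀ j, yD n (j + 1) = yD n j - 2 := fun j => by simp only [yD]; push_cast; ring
  have hy0 : ∀ j, yD n j ≤ -2 := fun j => by simp only [yD]; omega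
  refine ⟨fun j => ?_, fun j => ?_, fun j => ?_, fun j t => ?_, fun j t₁ t₂ => ?_, fun j t₁ t₂ => ?_, fun j t₁ t₂ => ?_⟩
  · rintro ⟨k, y⟩ h; rw [mem_SD] at h ⊢; rw [hy]; have := hy0 j; omega
  · rw [Finset.disjoint_left]; rintro ⟨k, y⟩ h1 h2; rw [mem_SD] at h1; rw [mem_ΦD] at h2; have := hy0 j; omega
  · intro b b' hb
    have e : ∀ (c : Fin 3) (y : ℤ), (y = yD n j ∨ y = yD n j - 1) → col τ κ₀ κ₂ b c y = col τ κ₀ κ₂ b' c y := by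
      intro c y hyy
      have h0 : b (0, y) = b' (0, y) := hb _ ((mem_SD n (j + 1) 0 y).2 (by rw [hy]; have := hy0 j; omega))
      have h4 : b (4, 1) = b' (4, 1) := hb _ ((mem_SD n (j + 1) 4 1).2 (Or.inl ⟨rfl, rfl⟩))
      have hk : ∀ k : Fin 5, (k = 1 ∨ k = 3) → bp (fun s => b (k, s)) 0 y = bp (fun s => b' (k, s)) 0 y :=
        fun k hk => bp_congr fun s hs1 hs2 => hb _ ((mem_SD n (j + 1) k s).2 (Or.inr (Or.inl ⟨hk, by
          rw [hy]; have := hy0 j; omega⟩)))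
      have h13 : ∀ τ' : Bool, (kL τ' = 1 ∨ kL τ' = 3) := by decide
      fin_cases c
      · simp only [Fin.zero_eta, col_zero, h0]
      · simp only [Fin.mk_one, col_one, h0, h4, hk (kL τ) (h13 τ)]
      · simp only [Fin.reduceFinMk, col_two, h0, hk 1 (Or.inl rfl), hk 3 (Or.inr rfl)]
    simp only [AD, Set.mem_setOf_eq]
    constructor
    · rintro ⟨β, h1, h2⟩; exact ⟨β, fun c => by rw [← e c _ (Or.inl rfl)]; exact h1 c, fun c => by rw [← e c _ (Or.inr rfl)]; exact h2 c⟩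
    · rintro ⟨β, h1, h2⟩; exact ⟨β, fun c => by rw [e c _ (Or.inl rfl)]; exact h1 c, fun c => by rw [e c _ (Or.inr rfl)]; exact h2 c⟩
  · have key : ∀ k : Fin 5, (k = 1 ∨ k = 3) → {b | TD τ κ₀ κ₂ k n j b = t} ∈ DetSets (SD n j) := fun k hk b b' hb => by
      have h4 : b (4, 1) = b' (4, 1) := hb _ ((mem_SD n j 4 1).2 (Or.inl ⟨rfl, rfl⟩))
      have hk' : bp (fun s => b (k, s)) 0 (yD n j + 1) = bp (fun s => b' (k, s)) 0 (yD n j + 1) :=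
        bp_congr fun s hs1 hs2 => hb _ ((mem_SD n j k s).2 (Or.inr (Or.inl ⟨hk, by have := hy0 j; omega⟩)))
      simp only [Set.mem_setOf_eq, TD, h4, hk']
    exact ⟨key 1 (Or.inl rfl), key 3 (Or.inr rfl)⟩
  · intro b b' hb
    simp only [Set.mem_pi, Finset.mem_coe, Set.mem_singleton_iff]
    exact ⟨fun h idx hidx => by rw [← hb idx hidx]; exact h idx hidx, fun h idx hidx => by rw [hb idx hidx]; exact h idx hidx⟩
  · have hq := qI_val
    rw [measureReal_def, P_pi, ENNReal.toReal_prod]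
    have hfac : ∀ idx ∈ ΦD n j, (qI : ℝ) ≤ (ENNReal.ofReal (if βD n j t₁ t₂ idx then (wt idx.1 : ℝ) else 1 - wt idx.1)).toReal := by
      intro idx _
      rw [ENNReal.toReal_ofReal (by split_ifs; exacts [(wt idx.1).2.1, sub_nonneg.2 (wt idx.1).2.2])]
      unfold wt; split_ifs <;> (try simp only [coe_half]) <;> linarith
    have hcard : (ΦD n j).card ≤ 6 := by
      unfold ΦD
      refine (Finset.card_insert_le _ _).trans (Nat.succ_le_succ ((Finset.card_insert_le _ _).trans (Nat.succ_le_succ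
        ((Finset.card_insert_le _ _).trans (Nat.succ_le_succ ((Finset.card_insert_le _ _).trans (Nat.succ_le_succ
        ((Finset.card_insert_le _ _).trans (Nat.succ_le_succ (Finset.card_singleton _).le)))))))))
    calc (qI : ℝ) ^ 6 ≤ (qI : ℝ) ^ (ΦD n j).card := pow_le_pow_of_le_one (by linarith [hq.2.1]) (by linarith [hq.2.2]) hcard
      _ = ∏ idx ∈ ΦD n j, (qI : ℝ) := by rw [Finset.prod_const]
      _ ≤ _ := Finset.prod_le_prod (fun _ _ => hq.2.1.le.trans' (by norm_num)) hfac
  · rintro b ⟨⟨hbox, h1⟩, h3⟩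
    rw [Set.mem_pi] at hbox
    have hb : ∀ idx ∈ ΦD n j, b idx = βD n j t₁ t₂ idx := fun idx hidx => Set.mem_singleton_iff.1 (hbox idx (Finset.mem_coe.2 hidx))
    have hβ : ∀ (k : Fin 5) (y : ℤ), βD n j t₁ t₂ (k, y) =
        (if k = 1 ∧ y = yD n j then t₁ else if k = 3 ∧ y = yD n j then t₂ else
          if k = 0 ∧ y = yD n j - 1 then true else false) := fun k y => by simp only [βD, Prod.mk.injEq]
    have e1 : b (1, yD n j) = t₁ := by
      rw [hb _ ((mem_ΦD n j 1 _).2 (Or.inl ⟨Or.inl rfl, Or.inl rfl⟩)), hβ]; simp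
    have e3 : b (3, yD n j) = t₂ := by
      rw [hb _ ((mem_ΦD n j 3 _).2 (Or.inl ⟨Or.inr rfl, Or.inl rfl⟩)), hβ]; simp
    have e1' : b (1, yD n j - 1) = false := by
      rw [hb _ ((mem_ΦD n j 1 _).2 (Or.inl ⟨Or.inl rfl, Or.inr rfl⟩)), hβ]
      rw [if_neg (by omega), if_neg (by omega), if_neg (by omega)]
    have e3' : b (3, yD n j - 1) = false := by
      rw [hb _ ((mem_ΦD n j 3 _).2 (Or.inl ⟨Or.inr rfl, Or.inr rfl⟩)), hβ]
      rw [if_neg (by omega), if_neg (by omega), if_neg (by omega)]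
    have e0 : b (0, yD n j) = false := by
      rw [hb _ ((mem_ΦD n j 0 _).2 (Or.inr ⟨rfl, Or.inl rfl⟩)), hβ]
      rw [if_neg (by omega), if_neg (by omega), if_neg (by omega)]
    have e0' : b (0, yD n j - 1) = true := by
      rw [hb _ ((mem_ΦD n j 0 _).2 (Or.inr ⟨rfl, Or.inr rfl⟩)), hβ]
      rw [if_neg (by omega), if_neg (by omega), if_pos ⟨rfl, rfl⟩]
    rw [Set.mem_setOf_eq, TD] at h1 h3
    have hp1 : bp (fun s => b (1, s)) 0 (yD n j) = (b (4, 1) ^^ κk τ κ₀ κ₂ 1) := by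
      have := bp_succ (fun s => b (1, s)) (yD n j)
      rw [this, e1] at h1
      revert h1; cases bp (fun s => b (1, s)) 0 (yD n j) <;> cases b (4, 1) <;> cases κk τ κ₀ κ₂ 1 <;> cases t₁ <;> decide
    have hp3 : bp (fun s => b (3, s)) 0 (yD n j) = (b (4, 1) ^^ κk τ κ₀ κ₂ 3) := by
      have := bp_succ (fun s => b (3, s)) (yD n j)
      rw [this, e3] at h3
      revert h3; cases bp (fun s => b (3, s)) 0 (yD n j) <;> cases b (4, 1) <;> cases κk τ κ₀ κ₂ 3 <;> cases t₂ <;> decide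
    have hp1' : bp (fun s => b (1, s)) 0 (yD n j - 1) = (b (4, 1) ^^ κk τ κ₀ κ₂ 1) := by
      have := bp_succ (fun s => b (1, s)) (yD n j - 1)
      rw [sub_add_cancel, hp1, e1'] at this
      revert this; cases bp (fun s => b (1, s)) 0 (yD n j - 1) <;> cases b (4, 1) <;> cases κk τ κ₀ κ₂ 1 <;> decide
    have hp3' : bp (fun s => b (3, s)) 0 (yD n j - 1) = (b (4, 1) ^^ κk τ κ₀ κ₂ 3) := by
      have := bp_succ (fun s => b (3, s)) (yD n j - 1)
      rw [sub_add_cancel, hp3, e3'] at this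
      revert this; cases bp (fun s => b (3, s)) 0 (yD n j - 1) <;> cases b (4, 1) <;> cases κk τ κ₀ κ₂ 3 <;> decide
    have hrow : ∀ (y : ℤ) (r : Bool), b (0, y) = r → bp (fun s => b (1, s)) 0 y = (b (4, 1) ^^ κk τ κ₀ κ₂ 1) →
        bp (fun s => b (3, s)) 0 y = (b (4, 1) ^^ κk τ κ₀ κ₂ 3) → ∀ c : Fin 3, col τ κ₀ κ₂ b c y = (κ₀ ^^ r) := by
      intro y r hr h1 h3 c
      have hL : bp (fun s => b (kL τ, s)) 0 y = (b (4, 1) ^^ κ₀) := by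
        cases τ
        · simp only [kL, Bool.false_eq_true, if_false] at h3 ⊢; rw [h3]; simp [κk, kL]
        · simp only [kL, if_true] at h1 ⊢; rw [h1]; simp [κk, kL]
      fin_cases c
      · simp only [Fin.zero_eta, col_zero, hr]
      · simp only [Fin.mk_one, col_one, hr, hL]; cases b (4, 1) <;> cases κ₀ <;> cases r <;> rfl
      · simp only [Fin.reduceFinMk, col_two, hr, h1, h3]
        cases τ <;> simp [κk, kL] <;> cases b (4, 1) <;> cases κ₀ <;> cases κ₂ <;> cases r <;> rfl
    exact ⟨κ₀ ^^ false, hrow _ _ e0 hp1 hp3, fun c => by rw [hrow _ _ e0' hp1' hp3']; cases κ₀ <;> rfl⟩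

/-- THE LOWER BLOCKING BOUND. [folklore] -/
theorem P_noBlockD (τ κ₀ κ₂ : Bool) (n k : ℕ) :
    P.real (⋂ j ∈ Finset.range k, (AD τ κ₀ κ₂ n j)ᶜ) ≤ (1 - (qI : ℝ) ^ 6) ^ k := by
  obtain ⟨h1, h3, h4, h5, h6, h7, h8⟩ := slotsD_ok τ κ₀ κ₂ n
  exact blocking_abstract (AD τ κ₀ κ₂ n) (SD n) (ΦD n) (TD τ κ₀ κ₂ 1 n) (TD τ κ₀ κ₂ 3 n)
    (fun j t₁ t₂ => Set.pi ↑(ΦD n j) (fun idx => {βD n j t₁ t₂ idx})) _ h1 h3 h4 h5 h6 h7 h8 k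

/-! ## §20 Exits are blocked -/

/-- Strip edges change rows by at most one. [folklore] -/
theorem row_step (A : Set (Site 2)) (u v : Site 2) (h : (cellGraph A).Adj u v) : v 1 ≤ u 1 + 1 ∧ u 1 ≤ v 1 + 1 := by
  have := grid_adj_near _ ((cellGraph_adj_iff A u v).1 h)
  simp only at this; omega

/-- A monochromatic path cannot cross two monochromatic rows of opposite colours. [folklore] -/
theorem no_cross (i : ℤ) (τ κ₀ κ₂ : Bool) (b : K) {lo hi : ℤ} {p : Site 2} (hp : p ∈ clsW (X i τ κ₀ κ₂ b) i lo hi p)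
    {u u' : Site 2} (hu : (within (cellGraph (X i τ κ₀ κ₂ b).2) (clsW (X i τ κ₀ κ₂ b) i lo hi p)).Reachable p u)
    (hu' : (within (cellGraph (X i τ κ₀ κ₂ b).2) (clsW (X i τ κ₀ κ₂ b) i lo hi p)).Reachable p u')
    {β : Bool} (h1 : ∀ c : Fin 3, col τ κ₀ κ₂ b c (u 1) = β) (h2 : ∀ c : Fin 3, col τ κ₀ κ₂ b c (u' 1) = !β) : False := by
  have hum := within_reachable_mem _ _ hu hp
  have hum' := within_reachable_mem _ _ hu' hp
  have hj : u 0 = i + ((⟨(u 0 - i).toNat, by have := hum.1.2; omega⟩ : Fin 3) : ℕ) := by simp; have := hum.1.2; omega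
  have hj' : u' 0 = i + ((⟨(u' 0 - i).toNat, by have := hum'.1.2; omega⟩ : Fin 3) : ℕ) := by simp; have := hum'.1.2; omega
  have e := hum.1.1; have e' := hum'.1.1
  rw [mem_X_iff i τ κ₀ κ₂ b u _ hj, h1] at e
  rw [mem_X_iff i τ κ₀ κ₂ b u' _ hj', h2] at e'
  have ee := e.trans e'.symm
  revert ee; cases β <;> simp

/-- UPWARD EXITS ARE BLOCKED by any blocking upper slot below the top row. [folklore] -/
theorem up_blocked (i : ℤ) (τ κ₀ κ₂ : Bool) (b : K) (n m : ℕ) (p w : Site 2) (hp0 : i ≤ p 0 ∧ p 0 ≤ i + 2)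
    (hp1 : -(m : ℤ) ≤ p 1 ∧ p 1 ≤ n) (hw : w 1 = m)
    (hr : (within (cellGraph (X i τ κ₀ κ₂ b).2) (clsW (X i τ κ₀ κ₂ b) i (-m) m p)).Reachable p w) (j : ℕ)
    (hj : yU n j + 1 ≤ m) : b ∉ AU τ κ₀ κ₂ n j := by
  rintro ⟨β, h1, h2⟩
  have hyu : p 1 ≤ yU n j := by simp only [yU]; omega
  have hp : p ∈ clsW (X i τ κ₀ κ₂ b) i (-m) m p := ⟨⟨Iff.rfl, hp0⟩, hp1.1, by omega⟩
  have hG : ∀ u v : Site 2, (within (cellGraph (X i τ κ₀ κ₂ b).2) (clsW (X i τ κ₀ κ₂ b) i (-m) m p)).Adj u v →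
      v 1 ≤ u 1 + 1 := fun u v huv => (row_step _ u v huv.1).1
  obtain ⟨u, hu, hur⟩ := exists_row_eq _ (fun v : Site 2 => v 1) hG hr (yU n j) hyu (by omega)
  obtain ⟨u', hu', hur'⟩ := exists_row_eq _ (fun v : Site 2 => v 1) hG hr (yU n j + 1) (by omega) (by omega)
  exact no_cross i τ κ₀ κ₂ b hp hu hu' (fun c => by rw [hur]; exact h1 c) (fun c => by rw [hur']; exact h2 c)

/-- DOWNWARD EXITS ARE BLOCKED by any blocking lower slot above the bottom row. [folklore] -/
theorem down_blocked (i : ℤ) (τ κ₀ κ₂ : Bool) (b : K) (n m : ℕ) (p w : Site 2) (hp0 : i ≤ p 0 ∧ p 0 ≤ i + 2)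
    (hp1 : -(n : ℤ) ≤ p 1 ∧ p 1 ≤ m) (hw : w 1 = -m)
    (hr : (within (cellGraph (X i τ κ₀ κ₂ b).2) (clsW (X i τ κ₀ κ₂ b) i (-m) m p)).Reachable p w) (j : ℕ)
    (hj : -(m : ℤ) ≤ yD n j - 1) : b ∉ AD τ κ₀ κ₂ n j := by
  rintro ⟨β, h1, h2⟩
  have hyu : -(p 1) ≤ -(yD n j) := by simp only [yD]; omega
  have hp : p ∈ clsW (X i τ κ₀ κ₂ b) i (-m) m p := ⟨⟨Iff.rfl, hp0⟩, by omega, hp1.2⟩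
  have hG : ∀ u v : Site 2, (within (cellGraph (X i τ κ₀ κ₂ b).2) (clsW (X i τ κ₀ κ₂ b) i (-m) m p)).Adj u v →
      -(v 1) ≤ -(u 1) + 1 := fun u v huv => by have := (row_step _ u v huv.1).2; omega
  obtain ⟨u, hu, hur⟩ := exists_row_eq _ (fun v : Site 2 => -(v 1)) hG hr (-(yD n j)) hyu (by omega)
  obtain ⟨u', hu', hur'⟩ := exists_row_eq _ (fun v : Site 2 => -(v 1)) hG hr (-(yD n j - 1)) (by omega) (by omega)
  simp only [neg_inj] at hur hur'
  exact no_cross i τ κ₀ κ₂ b hp hu hu' (fun c => by rw [hur]; exact h1 c) (fun c => by rw [hur']; exact h2 c)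

/-- THE EXIT BOUND: `P(G_m) ≤ 2 |P| (1 - q^6)^k` once the window `[-m, m]` contains `k` slots above and below the
starts. [folklore] -/
theorem P_Gex_le (i : ℤ) (τ κ₀ κ₂ : Bool) (Pp : Finset (Site 2 × Site 2)) (n m k : ℕ)
    (hPp : ∀ pq ∈ Pp, (pq.1 0 = i ∨ pq.1 0 = i + 2) ∧ -(n : ℤ) ≤ pq.1 1 ∧ pq.1 1 ≤ n) (hk : (n : ℤ) + 2 * k + 2 ≤ m) :
    P.real (Gex i τ κ₀ κ₂ Pp m) ≤ 2 * Pp.card * (1 - (qI : ℝ) ^ 6) ^ k := by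
  have hsub : Gex i τ κ₀ κ₂ Pp m ⊆ ⋃ pq ∈ Pp, ((⋂ j ∈ Finset.range k, (AU τ κ₀ κ₂ n j)ᶜ) ∪ (⋂ j ∈ Finset.range k, (AD τ κ₀ κ₂ n j)ᶜ)) := by
    rintro b ⟨pq, hpq, w, hw, hr⟩
    obtain ⟨h0, h1, h2⟩ := hPp pq hpq
    simp only [Set.mem_iUnion, Set.mem_union, Set.mem_iInter, Set.mem_compl_iff, Finset.mem_range]
    refine ⟨pq, hpq, ?_⟩
    rcases hw with hw | hw
    · right; intro j hj
      exact down_blocked i τ κ₀ κ₂ b n m pq.1 w (by omega) ⟨h1, by omega⟩ hw hr j (by simp only [yD]; nlinarith)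
    · left; intro j hj
      exact up_blocked i τ κ₀ κ₂ b n m pq.1 w (by omega) ⟨by omega, h2⟩ hw hr j (by simp only [yU]; nlinarith)
  calc P.real (Gex i τ κ₀ κ₂ Pp m) ≤ P.real (⋃ pq ∈ Pp, ((⋂ j ∈ Finset.range k, (AU τ κ₀ κ₂ n j)ᶜ) ∪ (⋂ j ∈ Finset.range k, (AD τ κ₀ κ₂ n j)ᶜ))) :=
        measureReal_mono hsub (measure_ne_top P _)
    _ ≤ ∑ pq ∈ Pp, P.real ((⋂ j ∈ Finset.range k, (AU τ κ₀ κ₂ n j)ᶜ) ∪ (⋂ j ∈ Finset.range k, (AD τ κ₀ κ₂ n j)ᶜ)) :=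
        measureReal_biUnion_finset_le _ _
    _ ≤ ∑ pq ∈ Pp, (P.real (⋂ j ∈ Finset.range k, (AU τ κ₀ κ₂ n j)ᶜ) + P.real (⋂ j ∈ Finset.range k, (AD τ κ₀ κ₂ n j)ᶜ)) :=
        Finset.sum_le_sum fun pq _ => measureReal_union_le _ _
    _ ≤ ∑ pq ∈ Pp, 2 * (1 - (qI : ℝ) ^ 6) ^ k :=
        Finset.sum_le_sum fun pq _ => by have := P_noBlockU τ κ₀ κ₂ n k; have := P_noBlockD τ κ₀ κ₂ n k; linarith
    _ = 2 * Pp.card * (1 - (qI : ℝ) ^ 6) ^ k := by rw [Finset.sum_const, nsmul_eq_mul]; ring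


end SDE

/-- THE EXIT BOUND (part 8 of `stub_StripDiagramExchange`). [folklore] -/
theorem stripDX_exitBound : ∀ (i : ℤ) (τ κ₀ κ₂ : Bool) (Pp : Finset (Site 2 × Site 2)) (n m k : ℕ), (∀ pq ∈ Pp, (pq.1 0 = i ∨ pq.1 0 = i + 2) ∧ -(n : ℤ) ≤ pq.1 1 ∧ pq.1 1 ≤ n) → (n : ℤ) + 2 * k + 2 ≤ m → SDE.P.real (SDE.Gex i τ κ₀ κ₂ Pp m) ≤ 2 * Pp.card * (1 - (SDE.qI : ℝ) ^ 6) ^ k :=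
  fun i τ κ₀ κ₂ Pp n m k hPp hk => SDE.P_Gex_le i τ κ₀ κ₂ Pp n m k hPp hk

end Summit.CriticalPhenomena.CardyFormulaZ2.Theorems.IKLinearTransport.PinnedDiagramExchange
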